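import Summits.HodgeConjecture.HodgeConjecture.Theses.DerivedTorelliFermat
import Summits.HodgeConjecture.HodgeConjecture.Theorems.LimitExtensionHodgeFourfoldsLefschetzDischarged
import Literature.AlgebraicGeometry.HodgeTheory.FermatHodgeConjectureAssembly

/-!
# Route DerivedTorelliFermat — `TargetGlue` (glue item stmt-HodgeConjecture-14582)

`TargetGlue := HypersurfaceLefschetz → HodgeModels → EigenspaceInputs → ShiodaAokiSupply →
K3SectorAlgebraic → FermatFourfoldsHCModResidual`: the Hodge conjecture for every Fermat fourfold
`X⁴ₘ` granted (i) the eigenspace structure of `H⁴` of the standard model under `μₘ⁶`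
(`EigenspaceInputs`: `V(α) = 0` in degree `4` for `α ≠ 0` with some `αᵢ = 0`; `V(0)` restricted from
`ℙ⁵`; the `(2,2)`-eigenlines have `|α| = 3`), (ii) algebraicity of `V(α)` for the Shioda–Aoki
decomposable Hodge characters (`ShiodaAokiSupply`) and for the K3-type characters
(`K3SectorAlgebraic`), and (iii) — the hypothesis of the target — algebraicity of `V(α)` for the
residual Hodge characters (neither decomposable nor of K3 type).

Proof.  Ran's assembly of the middle degree from the eigenspace structure is a THEOREM of the tree,
`mem_algebraicClasses_fermat_middle_of_eigenspaces` (file `FermatHodgeConjectureAssembly`): every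
rational `(2,2)`-class of the standard model `V₊(Σ xᵢᵐ) ⊂ ℙ⁵` is the sum of its `V(α)`-components,
the invariant one comes from `ℙ⁵`, the others are carried by Hodge characters, and `V(α)` is
algebraic for every Hodge character by the three-way case split decomposable / K3-type / residual.
The route states eigen-conditions explicitly ("`g_a^* c = (∏ aᵢ^{αᵢ}) • c` for all `a ∈ μₘ⁶`"); the
dictionary with the tree's `fermatEigenspace` is `mem_fermatEigenspace_iff` + `fermatCharacter_apply`
(`derivedTorelliFermat_diagonalMap_eq_of_mem_fermatEigenspace`).  The middle degree is transported
from the standard model to `X` along `IsFermatVariety.isoFermatHypersurface`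
(`IsOfHodgeType.map_of_iso`, `mem_algebraicClasses_map_of_iso`), and the other codimensions of a
smooth projective fourfold are unconditional (`hodgeConjectureFor_four_of_hodgeTwoTwo`: Hodge models,
Lefschetz `(1,1)`, hard Lefschetz) — so the hypotheses `HypersurfaceLefschetz` and `HodgeModels` are
not even used.  No named-fact hypothesis, no sorry.
-/

-- `Summit.HodgeConjecture.HodgeConjecture.Theorems` is the mandated namespace (single-problem
-- summit: Problem = Summit), which `linter.dupNamespace` flags on every declaration; the lakefile
-- turns the linter off tree-wide (weak option), restated here so stand-alone elaboration is
-- warning-free too.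
set_option linter.dupNamespace false

noncomputable section

namespace Summit.HodgeConjecture.HodgeConjecture.Theorems

open CategoryTheory Literature.AlgebraicGeometry.Motives Literature.AlgebraicGeometry.HodgeTheory
  Literature.AlgebraicTopology.SingularHomology

/-- **Dictionary: the tree's eigenspace `V(α)` ⟹ the route's explicit eigen-condition.** A class
`c ∈ V(α) ⊆ Hᵏ(Xⁿₘ(ℂ); ℂ)` satisfies `g_a^* c = (∏ᵢ aᵢ^{⟨αᵢ⟩}) • c` for every diagonal `a` with
`aᵢᵐ = 1` (`mem_fermatEigenspace_iff`, `fermatCharacter_apply`). [cite: Shioda1979PJA, §4] -/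
theorem derivedTorelliFermat_diagonalMap_eq_of_mem_fermatEigenspace {n m : ℕ}
    {α : Fin (n + 2) → ZMod m} {k : ℕ}
    {c : complexBetti (SmoothHypersurface.hypersurface (fermatPolynomial ℂ n m)) k}
    (hc : c ∈ fermatEigenspace m α k) (a : Fin (n + 2) → ℂˣ)
    (ha : a ∈ diagonalStabilizer (fermatPolynomial ℂ n m)) (hm : ∀ i, a i ^ m = 1) :
    singularCohomology.map ℂ ℂ (diagonalMap (fermatPolynomial ℂ n m) ha) k c =
      (∏ i, (a i : ℂ) ^ (α i).val) • c := by
  have h := (mem_fermatEigenspace_iff.1 hc) ⟨a, mem_fermatGroup_iff.2 hm⟩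
  simp only [fermatCharacter_apply, Units.coe_prod, Units.val_pow_eq_pow_val] at h
  exact h

/-- Three-way case split used for the Hodge characters (decomposable / K3-type / residual).
[folklore] -/
private theorem derivedTorelliFermat_cases {P Q R : Prop} (h1 : P → R) (h2 : Q → R)
    (h3 : ¬ P → ¬ Q → R) : R := by
  by_cases hP : P
  · exact h1 hP
  by_cases hQ : Q
  · exact h2 hQ
  exact h3 hP hQ

/-- **Item stmt-HodgeConjecture-14582 (`TargetGlue`), route `DerivedTorelliFermat`**:
`HypersurfaceLefschetz → HodgeModels → EigenspaceInputs → ShiodaAokiSupply → K3SectorAlgebraic →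
FermatFourfoldsHCModResidual`.  Middle degree on the standard model by Ran's assembly
`mem_algebraicClasses_fermat_middle_of_eigenspaces` (the eigenspace inputs via the dictionary above,
the algebraicity of the Hodge eigenlines by the case split decomposable / K3-type / residual);
transport to the given Fermat fourfold along `IsFermatVariety.isoFermatHypersurface`; the other
codimensions by `hodgeConjectureFor_four_of_hodgeTwoTwo`.  The type is the route decl
`Summit.HodgeConjecture.HodgeConjecture.Theses.DerivedTorelliFermat.TargetGlue`.
[cite: Ran1980, Thm. 4.9 and §1 Prop. 1.7] [cite: Shioda1979PJA, §2 Thm. 1 and §4]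
[cite: Hartshorne1977, II Ex. 3.11 (d)] -/
theorem derivedTorelliFermat_targetGlue_proof :
    Summit.HodgeConjecture.HodgeConjecture.Theses.DerivedTorelliFermat.TargetGlue := by
  intro _hL _hM hE hSA hK3 m _ hRes X hF hX
  obtain ⟨hE2, hE0, hE4⟩ := hE m
  -- Step 1: the middle degree on the standard model `V₊(Σ xᵢᵐ) ⊂ ℙ⁵`
  have hmid : ∀ c : complexBetti (fermatHypersurface (2 * 2) m) (2 * 2), IsRationalClass c →
      IsOfHodgeType (2 * 2) (fermatHypersurface (2 * 2) m) (2 * 2) 2 2 c →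
        c ∈ algebraicClasses (fermatHypersurface (2 * 2) m) 2 := by
    refine mem_algebraicClasses_fermat_middle_of_eigenspaces two_pos ?_ ?_ ?_ ?_
    · intro α hα0 hαi
      exact (Submodule.eq_bot_iff _).2 fun c hc ↦
        hE2 α hα0 hαi c (derivedTorelliFermat_diagonalMap_eq_of_mem_fermatEigenspace hc)
    · intro c hc
      exact hE0 c (derivedTorelliFermat_diagonalMap_eq_of_mem_fermatEigenspace hc)
    · rintro A β hβ ⟨x, hx, hx0, hxA⟩
      exact hE4 A β hβ ⟨x, derivedTorelliFermat_diagonalMap_eq_of_mem_fermatEigenspace hx, hx0, hxA⟩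
    · intro α hα c hc
      exact derivedTorelliFermat_cases (hSA m α hα) (hK3 m α hα) (hRes α hα) c
        (derivedTorelliFermat_diagonalMap_eq_of_mem_fermatEigenspace hc)
  -- Step 2: transport to `X` along `X ≅ V₊(Σ xᵢᵐ)` and conclude in every codimension
  have hF' : IsFermatVariety (2 * 2) m X := hF
  have hX2 : IsSmoothProjective (2 * 2) X := hX
  have hX' : IsSmoothProjective (2 * 2) (fermatHypersurface (2 * 2) m) :=
    isSmoothProjective_fermatHypersurface (by omega) NeZero.one_le
  let e : X ≅ fermatHypersurface (2 * 2) m := hF'.isoFermatHypersurface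
  refine hodgeConjectureFor_four_of_hodgeTwoTwo hX fun c hc hpp ↦ ?_
  have hpp' : IsOfHodgeType (2 * 2) X (2 * 2) 2 2 c := hpp
  set c' : complexBetti (fermatHypersurface (2 * 2) m) (2 * 2) :=
    singularCohomology.map ℂ ℂ (AlgPoints.mapContinuous (L := ℂ) e.inv) (2 * 2) c with hc'
  have hc'rat : IsRationalClass c' := hc.map _
  have hc'pp : IsOfHodgeType (2 * 2) (fermatHypersurface (2 * 2) m) (2 * 2) 2 2 c' :=
    hpp'.map_of_iso e.symm
  have halg := mem_algebraicClasses_map_of_iso hX' hX2 e (hmid c' hc'rat hc'pp)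
  rwa [hc', show complexBetti.map e.hom (2 * 2)
      (singularCohomology.map ℂ ℂ (AlgPoints.mapContinuous (L := ℂ) e.inv) (2 * 2) c) = c from
    map_hom_map_inv_apply e (2 * 2) c] at halg

end Summit.HodgeConjecture.HodgeConjecture.Theorems

end
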